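import Summits.CriticalPhenomena.PercolationContinuityZ3.Theorems.Transplant.FKDoubleFanOneSidedConeSCrossCorner
import HarnessLib

/-!
# Double fans `K₂ ∨ P_{m+1}`: the exact criterion holds on the whole cell {ALL gadgets} × {`P_b`-type rests} — the CHORD derivative

Helper file (`--supports stmt-CriticalPhenomena-4575`), FK sub-lane `prim-bschramm-fk-3` (gen 39); builds on p205010 (kernel theorem, internal audit
signed; external expert review pending).  No named facts, no sorries; standard axioms.  Memo `bschramm/prim-bschramm-fk-3/FAR-CROSS-XIV.md` §0(B), §3.

`…ConeSCrossCorner` discharged cross-positivity of `T_b` (the exact criterion of `…ConeSCross`/`…ConeSSigns` for `HypBaS`) at the cut gadgets on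
`P_b`-type rests.  Here the gadget is ARBITRARY: for every `F` and every `P_b`-type rest `w = (0, 0, 0, b, c)` (`= BC_1 ∗ edgeAB t` up to scale),
  `T_b (imgA F w) = ∂_ε imgA (F + ε·(AC_1 ∗ F)) w |₀`,   `AC_1 ∗ F = (0, 0, F₀ + F_ac, 0, F_ab + F_bc + F₁)`,
i.e. `T_b` of the atom is the derivative along the CHORD `c_in — c_out` added to the gadget (`AC_x ∗ F`, a letter step, so the path stays in `InS q`):
**`imgA_conv_edgeAC_pinB`**: `imgA (AC_x ∗ F) w = (1−x)²·imgA F w + x(1−x)·T_b (imgA F w) + x²·imgA (AC_1 ∗ F) w`.  Hence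
**`crossPos_pinB`**: for `0 < q ≤ 1`, `F ∈ InS q`, `t ∈ [0,1]` and every `ρ ∈ OSDualS q` with `⟪imgA F (BC_1 ∗ edgeAB t), ρ⟫ = 0`:
`0 ≤ ⟪T_b (imgA F (BC_1 ∗ edgeAB t)), ρ⟫` (and the scaled form **`crossPos_pinB_smul`** for points of `atomClosure q` on these rays).
With `…ConeSRelabel` (`a_zv = N^{bc}(F^τ ∗ w)`): on this cell the whole `T_b`-parabola is explicit.
[folklore]
-/

noncomputable section

namespace Summit.CriticalPhenomena.PercolationContinuityZ3.Theorems

namespace FK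

namespace ThreeApex

/-- The chord applied to a gadget vector: `AC_1 ∗ F = (0, 0, F₀ + F_ac, 0, F_ab + F_bc + F₁)`. [folklore] -/
theorem conv_edgeAC_one_gadget (F : V5) : conv (edgeAC 1) F = ⟨0, 0, F.z0 + F.zac, 0, F.zab + F.zbc + F.z1⟩ := by
  ext <;> simp only [conv, edgeAC, V5.total] <;> ring

/-- **The chord path is the `T_b`-parabola on `P_b`-type rests**: `imgA (AC_x ∗ F) w = (1−x)²·a + x(1−x)·T_b a + x²·imgA (AC_1 ∗ F) w`,
`a = imgA F w`, `w = (0,0,0,b,c)`, for EVERY gadget vector `F`. [folklore] -/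
theorem imgA_conv_edgeAC_pinB (q x b c : ℝ) (F : V5) :
    imgA q (conv (edgeAC x) F) ⟨0, 0, 0, b, c⟩ =
      Biv.lin3 ((1 - x) ^ 2) (imgA q F ⟨0, 0, 0, b, c⟩) (x * (1 - x)) (opTb (imgA q F ⟨0, 0, 0, b, c⟩))
        (x ^ 2) (imgA q (conv (edgeAC 1) F) ⟨0, 0, 0, b, c⟩) := by
  ext <;> simp only [imgA, wedgeH, fanCombo, conv, edgeAC, detach, V5.total, hx, hy, hz, opTb, Biv.lin3, Biv.add, Biv.smul] <;> ring

/-- **Cross-positivity of `T_b` on {all gadgets} × {`P_b`-type rests}** (`0 < q ≤ 1`): the exact criterion holds at every atom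
`imgA F (BC_1 ∗ edgeAB t)`, `F ∈ InS q`, `t ∈ [0,1]`. [folklore] -/
theorem crossPos_pinB {q : ℝ} (hq0 : 0 < q) (hq1 : q ≤ 1) {F : V5} (hF : InS q F) {t : ℝ} (ht0 : 0 ≤ t) (ht1 : t ≤ 1)
    {ρ : Biv} (hρ : OSDualS q ρ) (h0 : pairH q (imgA q F (conv (edgeBC 1) (edgeAB t))) ρ = 0) :
    0 ≤ pairH q (opTb (imgA q F (conv (edgeBC 1) (edgeAB t)))) ρ := by
  have hw : InS q (conv (edgeBC 1) (edgeAB t)) := ((IsLetter.ab ht0 ht1).inS hq0 hq1).step hq0 hq1 (IsLetter.bc zero_le_one le_rfl)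
  refine nonneg_of_convex_comb_nonneg (R := pairH q (imgA q (conv (edgeAC 1) F) (conv (edgeBC 1) (edgeAB t))) ρ) fun s hs0 hs1 => ?_
  have hZ : InS q (conv (edgeAC s) F) := hF.step hq0 hq1 (IsLetter.ac hs0.le hs1.le)
  have key := hρ _ _ hZ hw
  rw [conv_edgeBC_one_edgeAB, imgA_conv_edgeAC_pinB, pairH_lin3_left] at key
  rw [conv_edgeBC_one_edgeAB] at h0 ⊢
  rw [h0, mul_zero, zero_add] at key
  have e : s * (1 - s) * pairH q (opTb (imgA q F ⟨0, 0, 0, 1 - t, t⟩)) ρ + s ^ 2 * pairH q (imgA q (conv (edgeAC 1) F) ⟨0, 0, 0, 1 - t, t⟩) ρ =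
      s * ((1 - s) * pairH q (opTb (imgA q F ⟨0, 0, 0, 1 - t, t⟩)) ρ + s * pairH q (imgA q (conv (edgeAC 1) F) ⟨0, 0, 0, 1 - t, t⟩) ρ) := by
    ring
  rw [e] at key
  exact (mul_nonneg_iff_of_pos_left hs0).1 key

/-- The scaled form (rays of `atomClosure q` through these atoms). [folklore] -/
theorem crossPos_pinB_smul {q : ℝ} (hq0 : 0 < q) (hq1 : q ≤ 1) {F : V5} (hF : InS q F) {t : ℝ} (ht0 : 0 ≤ t) (ht1 : t ≤ 1)
    {c : ℝ} (hc : 0 ≤ c) {ρ : Biv} (hρ : OSDualS q ρ) (h0 : pairH q (Biv.smul c (imgA q F (conv (edgeBC 1) (edgeAB t)))) ρ = 0) :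
    0 ≤ pairH q (opTb (Biv.smul c (imgA q F (conv (edgeBC 1) (edgeAB t))))) ρ := by
  rcases hc.eq_or_lt with rfl | hc'
  · have h00 : ∀ β : Biv, opTb (Biv.smul 0 β) = Biv.smul 0 β := fun β => by
      ext <;> simp [opTb, Biv.smul]
    rw [h00, pairH_smul_left, zero_mul]
  · have hT : ∀ β : Biv, opTb (Biv.smul c β) = Biv.smul c (opTb β) := fun β => by
      ext <;> simp only [opTb, Biv.smul] <;> ring
    rw [pairH_smul_left] at h0
    rw [hT, pairH_smul_left]
    exact mul_nonneg hc (crossPos_pinB hq0 hq1 hF ht0 ht1 hρ ((mul_eq_zero.1 h0).resolve_left hc'.ne'))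

/-- **Diagonal gadgets commute with the `b`-spoke**: for `F = (0, 0, F_ac, 0, F₁)` (`Comb(F) = F_ac·I + F₁·P_a`) and every rest `w`,
`∧²BC_y (imgA F w) = imgA F (BC_y ∗ w)` — on this cell `HypBaS` is a one-atom identity. [folklore] -/
theorem opBC_imgA_diag (q y fac f1 : ℝ) (w : V5) :
    opBC y (imgA q ⟨0, 0, fac, 0, f1⟩ w) = imgA q ⟨0, 0, fac, 0, f1⟩ (conv (edgeBC y) w) := by
  ext <;> simp only [opBC, opTb, opWb, imgA, wedgeH, fanCombo, conv, edgeAC, edgeBC, detach, V5.total, hx, hy, hz, Biv.lin3, Biv.add, Biv.smul] <;>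
    ring

end ThreeApex

end FK

end Summit.CriticalPhenomena.PercolationContinuityZ3.Theorems
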